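import Mathlib

/-!
# Route «KPlusLogSqLaw» — piecewise-affine bookkeeping on the parameter line (definitions)

HONEST FRAMING.  Definitions file (D-0009: reviewed/audited) for the divide-and-conquer layer of the static-path tropical count
(val-sym-lift-p4 g6 `HOME/val-sym-lift-p4/STATIC-PATH-NLOGN.md` §5–6; kernel parts `…Theorems.KPlusLogSqLaw.StaticPathFold`, seat
val-sym-lift-p3 g6, 2026-08-27), a helper line toward the crux `WeakLifting` (item `stmt-ValiantsHypothesis-19561`, route
`KPlusLogSqLaw`) on its witness-plan stub `stub_tridiagonalSectorB` (tropical twin of the static tridiagonal sector).  It names ONE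
piece of bookkeeping: `PA g K` — «the real function `g` is affine on every closed interval whose interior misses the finite set `K`»
(a kink-set CERTIFICATE for a piecewise-affine function; `K` is an upper bound for the breakpoints, not the exact set) — and the set
`crossSet h K` of zeros of `h` lying inside a `K`-free open interval on which `h` is affine with nonzero slope (the transversal zeros that
a `max` of two functions with difference `h` can turn into new kinks).  No `Prop` about the route is asserted; nothing here bears on
`WeakLifting`, `TropicalB`, `KPlusLogSqLaw`, `MatrixDescartes` (stmt-ValiantsHypothesis-18050) or `VP ≠ VNP`.

[folklore] (piecewise-affine functions of one real variable).
-/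

set_option linter.dupNamespace false
set_option autoImplicit false

namespace Summit.ValiantsHypothesis.ValiantsHypothesis.Theorems.KPlusLogSqLaw

namespace PiecewiseAffine

/-- `Free K x y`: no point of the finite set `K` lies strictly between `x` and `y`. [folklore] -/
def Free (K : Finset ℝ) (x y : ℝ) : Prop := ∀ k ∈ K, k ≤ x ∨ y ≤ k

/-- `PA g K`: `g` is affine on every closed interval `[x, y]` whose interior misses `K` (a kink-set certificate). [folklore] -/
def PA (g : ℝ → ℝ) (K : Finset ℝ) : Prop :=
  ∀ x y : ℝ, x ≤ y → Free K x y → ∃ p q : ℝ, ∀ τ ∈ Set.Icc x y, g τ = p * τ + q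

/-- the TRANSVERSAL ZEROS of `h` relative to the certificate `K`: zeros of `h` inside a `K`-free open interval on which `h` is affine
with nonzero slope. [folklore] -/
def crossSet (h : ℝ → ℝ) (K : Finset ℝ) : Set ℝ :=
  {θ | h θ = 0 ∧ ∃ x y p q : ℝ, x < θ ∧ θ < y ∧ Free K x y ∧ p ≠ 0 ∧ ∀ τ ∈ Set.Icc x y, h τ = p * τ + q}

end PiecewiseAffine

end Summit.ValiantsHypothesis.ValiantsHypothesis.Theorems.KPlusLogSqLaw
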